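import Literature.AlgebraicGeometry.ComplexMultiplication.CyclotomicFermatCMTypesBadOddCharacterCountExact
import HarnessLib

/-!
# Koblitz–Rohrlich, REMARK 1 "It is also clear that `lim s(N) = 0`": for every `k`, `2k·#S₀(N) < φ(N)` (i.e. `s(N) < 1/k`) at every
# sufficiently large level `N` prime to `6`, with an explicit threshold

Layer `Literature/AlgebraicGeometry/ComplexMultiplication`, namespace `…ComplexMultiplication.CyclotomicFermatCMType`; sequel of
`CyclotomicFermatCMTypesBadOddCharacterCount` (K–R's injection `#S₀(N) ≤ Σ_{p ∣ N} T_p`, `T_p = #{ψ mod N_p odd : ψ(p) = 1}`, and the count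
`2·ord_{N_p}(p)·T_p ≤ φ(N_p)`) and `CyclotomicFermatCMTypesBadOddCharacterCountExact` (`#S(N) = φ(N)/2`).  THEOREMS ONLY (no definition,
no named fact, no `sorry`).

THE SOURCE.  N. Koblitz, D. Rohrlich, *Simple factors in the Jacobian of a Fermat curve*, Canad. J. Math. **30** (1978) 1183–1205, §2,
proof of the Proposition (p. 1190): "Thus `χ ∈ S₀(N)` if and only if there exists `p ∣ N/N₀` such that `χ₀(p) = 1`. … If `χ ∈ S₀(N)`, then
for some `i` the corresponding `χ₀` must be an odd character mod `Nᵢ` such that `χ₀(pᵢ) = 1`.  For fixed `i`, the number of such `χ₀` is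
`0` if `pᵢ` is a root of `−1 mod Nᵢ`, `½ #((ℤ/Nᵢℤ)^*/{pᵢʲ})` otherwise.  Thus, `s(N) = #S₀(N)/#S(N) ≤ Σᵢ …`" and REMARK 1 (p. 1192): "It is
clear from the above proof that `3/20` is the maximum for `s(N)`.  It is also clear that `lim s(N) = 0`."

WHAT IS PROVED (K–R give no further word; the following elementary argument is ours and is the content of this file).  Fix `k` and a level
`N` all of whose prime factors are `≥ 5`, `m = ω(N)`.  For `ℓ ∣ N` write `a = v_ℓ(N)`, `N_ℓ = N/ℓᵃ`, `d = ord_{N_ℓ}(ℓ)` (the order of `ℓ` in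
`ℤ/N_ℓℤ`).  (i) If `k·m < φ(ℓᵃ)·d` for EVERY `ℓ ∣ N`, then `2(km + 1)·T_ℓ ≤ 2φ(ℓᵃ)·d·T_ℓ ≤ φ(ℓᵃ)φ(N_ℓ) = φ(N)`, so
`2(km + 1)·Σ_ℓ T_ℓ ≤ m·φ(N)` and `2k·#S₀(N) < φ(N)` (§3).  (ii) If `φ(ℓᵃ)·d ≤ k·m` for SOME `ℓ`, then `(ℓ − 1)d ≤ km`, the other `m − 1`
primes of `N` divide `N_ℓ ∣ ℓᵈ − 1`, so `((m − 1)!)⁴ ≤ N_ℓ⁴ < ℓ^{4d} ≤ 5^{(ℓ−1)d} ≤ 5^{km}` (`ℓ⁴ ≤ 5^{ℓ−1}` for `ℓ ≥ 5`), which with `cⁿ ≤ n!`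
for `n ≥ 2c²` (`c = 5ᵏ`) forces `m ≤ 2·25ᵏ`; and `ℓ ≤ km + 1`, `ℓ^{a−1} ≤ km`, `N_ℓ < ℓᵈ ≤ (km + 1)^{km}`, so `N < (km + 1)^{km + 2}` (§2).
Hence (§3) **for every `N ≥ (2k·25ᵏ + 1)^{2k·25ᵏ + 2}` with all prime factors `≥ 5`: `2k·#S₀(N) < φ(N)`**, i.e. `k·#S₀(N) < #S(N)`,
`s(N) < 1/k`; and the `ε`-form: for every rational `ε > 0` there is `N₀` with `s(N) < ε` for all such `N ≥ N₀` — "`lim s(N) = 0`".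

* §1 numerics (private): `ℓ⁴ ≤ 5^{ℓ−1}` (`ℓ ≥ 5`); `cⁿ ≤ n!` for `n ≥ 2c²`; `(#Q)! ≤ ∏ Q` for a finset of positive integers; `N_ℓ ∣ ℓ^{ord} − 1`.
* §2 `card_primeFactors_le_of_totient_mul_orderOf_le`, `lt_pow_of_totient_mul_orderOf_le` — the consequences of a failing term.
* §3 **`two_mul_mul_card_bad_lt_totient_of_forall_lt`** (the good case), **`two_mul_mul_card_bad_lt_totient_of_le`** (explicit threshold),
  `exists_forall_two_mul_mul_card_bad_lt_totient`, `mul_card_bad_lt_card_odd_of_le` (`k·#S₀(N) < #S(N)`), **`s_lt_one_div_of_le`**,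
  **`exists_forall_s_lt`** (the `ε`-form of "`lim s(N) = 0`").

## Honest column / NOT here

* The threshold `(2k·25ᵏ + 1)^{2k·25ᵏ + 2}` is a crude artefact of the proof (the true decay is of order `log log N / log N`); no rate is claimed.
* No `Filter.Tendsto` packaging (the ratio needs `NeZero N` levelwise); the `ε`–`N₀` statements are the limit as printed.
* Private copies: `dvd_pow_orderOf_sub_one`, `φ(N) = φ(ℓᵃ)·φ(N_ℓ)`, `2 < N`.

## References

* [KoblitzRohrlich1978] N. Koblitz, D. Rohrlich, Canad. J. Math. 30 (1978) 1183–1205: §2 Proposition and its proof (p. 1190), Remark 1 (p. 1192).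

## Provenance

Cell `pub-hodgecm2` (COR-CM), literature seat `lit-deligne-3` gen 36 (claim KR78-LIMIT-ZERO; count-neutral, own lane).
-/

noncomputable section

open NumberField

namespace Literature.AlgebraicGeometry.ComplexMultiplication

open Literature.NumberTheory.ComplexMultiplication
open Literature.NumberTheory.LFunctions

namespace CyclotomicFermatCMType

/-! ## §1 Numerics -/

section Numerics

/-- `ℓ⁴ ≤ 5^{ℓ−1}` for `ℓ ≥ 5`. [folklore] -/
private theorem pow_four_le_five_pow_sub_one {ℓ : ℕ} (hℓ : 5 ≤ ℓ) : ℓ ^ 4 ≤ 5 ^ (ℓ - 1) := by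
  induction ℓ, hℓ using Nat.le_induction with
  | base => norm_num
  | succ ℓ hℓ ih =>
    have h1 : (ℓ + 1) ^ 4 ≤ 5 * ℓ ^ 4 := by
      have h := Nat.pow_le_pow_left (show 5 * (ℓ + 1) ≤ 6 * ℓ by omega) 4
      rw [mul_pow, mul_pow] at h
      have h' : 5 ^ 4 * (ℓ + 1) ^ 4 ≤ 5 ^ 4 * (5 * ℓ ^ 4) :=
        h.trans (by rw [← mul_assoc]; exact Nat.mul_le_mul_right _ (by norm_num))
      exact Nat.le_of_mul_le_mul_left h' (by norm_num)
    calc (ℓ + 1) ^ 4 ≤ 5 * ℓ ^ 4 := h1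
      _ ≤ 5 * 5 ^ (ℓ - 1) := Nat.mul_le_mul_left _ ih
      _ = 5 ^ (ℓ + 1 - 1) := by rw [← pow_succ', show ℓ - 1 + 1 = ℓ + 1 - 1 by omega]

/-- `(c²)ʲ·(c²)! ≤ (c² + j)!`. [folklore] -/
private theorem sq_pow_mul_factorial_le (c : ℕ) : ∀ j : ℕ, (c ^ 2) ^ j * Nat.factorial (c ^ 2) ≤ Nat.factorial (c ^ 2 + j)
  | 0 => by simp
  | j + 1 => by
    calc (c ^ 2) ^ (j + 1) * Nat.factorial (c ^ 2) = c ^ 2 * ((c ^ 2) ^ j * Nat.factorial (c ^ 2)) := by ring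
      _ ≤ (c ^ 2 + j + 1) * Nat.factorial (c ^ 2 + j) := Nat.mul_le_mul (by omega) (sq_pow_mul_factorial_le c j)
      _ = Nat.factorial (c ^ 2 + (j + 1)) := by rw [← add_assoc, ← Nat.factorial_succ]

/-- **`cⁿ ≤ n!` for `n ≥ 2c²`.** [folklore] -/
private theorem pow_le_factorial_of_two_mul_sq_le {c n : ℕ} (hn : 2 * c ^ 2 ≤ n) : c ^ n ≤ Nat.factorial n := by
  induction n, hn using Nat.le_induction with
  | base =>
    have h := sq_pow_mul_factorial_le c (c ^ 2)
    rw [← pow_mul, show c ^ 2 + c ^ 2 = 2 * c ^ 2 by ring] at h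
    calc c ^ (2 * c ^ 2) = c ^ (2 * c ^ 2) * 1 := (mul_one _).symm
      _ ≤ c ^ (2 * c ^ 2) * Nat.factorial (c ^ 2) := Nat.mul_le_mul_left _ (Nat.factorial_pos _)
      _ ≤ Nat.factorial (2 * c ^ 2) := h
  | succ n hn ih =>
    have hc : c ≤ n + 1 := by nlinarith
    calc c ^ (n + 1) = c * c ^ n := by ring
      _ ≤ (n + 1) * Nat.factorial n := Nat.mul_le_mul hc ih
      _ = Nat.factorial (n + 1) := (Nat.factorial_succ n).symm

/-- **`(#Q)! ≤ ∏ Q`** for a finset `Q` of positive integers. [folklore] -/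
private theorem factorial_card_le_prod (Q : Finset ℕ) (hQ : ∀ q ∈ Q, 1 ≤ q) : Nat.factorial Q.card ≤ ∏ q ∈ Q, q := by
  classical
  induction Q using Finset.induction_on_max with
  | empty => simp
  | insert a s hlt ih =>
    have ha : a ∉ s := fun h => lt_irrefl a (hlt a h)
    have hs1 : ∀ q ∈ s, 1 ≤ q := fun q hq => hQ q (Finset.mem_insert_of_mem hq)
    have hcard : s.card + 1 ≤ a := by
      have hsub : s ⊆ Finset.Ico 1 a := fun q hq => Finset.mem_Ico.2 ⟨hs1 q hq, hlt q hq⟩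
      have := Finset.card_le_card hsub
      rw [Nat.card_Ico] at this
      have h1a : 1 ≤ a := hQ a (Finset.mem_insert_self a s)
      omega
    rw [Finset.prod_insert ha, Finset.card_insert_of_notMem ha, Nat.factorial_succ]
    exact Nat.mul_le_mul hcard (ih hs1)

/-- `M ∣ m^{ord(m)} − 1` for `m` prime to `M` (private copy of the siblings'). [folklore] -/
private theorem dvd_pow_orderOf_sub_one₇ {M : ℕ} [NeZero M] {m : ℕ} (hm : m.Coprime M) :
    M ∣ m ^ orderOf (ZMod.unitOfCoprime m hm) - 1 := by
  have hu : ((m : ZMod M)) ^ orderOf (ZMod.unitOfCoprime m hm) = 1 := by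
    rw [← ZMod.coe_unitOfCoprime m hm, ← Units.val_pow_eq_pow_val, pow_orderOf_eq_one, Units.val_one]
  rcases Nat.eq_zero_or_pos m with h0 | hpos
  · subst h0
    have hM : M = 1 := (Nat.coprime_zero_left _).1 hm
    subst hM
    exact one_dvd _
  have h1 : 1 ≤ m ^ orderOf (ZMod.unitOfCoprime m hm) := Nat.one_le_pow _ _ hpos
  have h : ((m ^ orderOf (ZMod.unitOfCoprime m hm) - 1 : ℕ) : ZMod M) = 0 := by
    rw [Nat.cast_sub h1, Nat.cast_pow, Nat.cast_one, hu, sub_self]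
  exact (ZMod.natCast_eq_zero_iff _ _).1 h

/-- `φ(N) = φ(ℓ^{v_ℓ(N)})·φ(N_ℓ)`. [folklore] -/
private theorem totient_eq_totient_ordProj_mul {N ℓ : ℕ} (hℓ : ℓ.Prime) (hN : N ≠ 0) :
    N.totient = (ordProj[ℓ] N).totient * (ordCompl[ℓ] N).totient := by
  have hcop : (ordProj[ℓ] N).Coprime (ordCompl[ℓ] N) := (Nat.coprime_ordCompl hℓ hN).pow_left _
  conv_lhs => rw [← Nat.ordProj_mul_ordCompl_eq_self N ℓ]
  exact Nat.totient_mul hcop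

end Numerics

/-! ## §2 A failing term `φ(ℓᵃ)·ord_{N_ℓ}(ℓ) ≤ k·ω(N)` bounds `ω(N)` and `N` -/

section Failing

variable {N : ℕ}

/-- The order of `ℓ` in `ℤ/N_ℓℤ` (as an element of the monoid `ZMod N_ℓ`) is the order of the unit `ℓ`, hence positive. [folklore] -/
private theorem orderOf_cast_pos [NeZero N] {ℓ : ℕ} (hℓ : ℓ ∈ N.primeFactors) : 0 < orderOf (ℓ : ZMod (ordCompl[ℓ] N)) := by
  haveI : NeZero (ordCompl[ℓ] N) := ⟨(Nat.ordCompl_pos ℓ (NeZero.ne N)).ne'⟩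
  have hcop : ℓ.Coprime (ordCompl[ℓ] N) := Nat.coprime_ordCompl (Nat.prime_of_mem_primeFactors hℓ) (NeZero.ne N)
  rw [← ZMod.coe_unitOfCoprime ℓ hcop, orderOf_units]
  exact orderOf_pos _

/-- The data of a prime `ℓ ∣ N` (all prime factors of `N` being `≥ 5`): with `d = ord_{N_ℓ}(ℓ)`, the other `ω(N) − 1` prime factors divide
`N_ℓ ∣ ℓᵈ − 1`, so `(ω(N) − 1)! ≤ N_ℓ < ℓᵈ`. [cite: KoblitzRohrlich1978, §2 proof of the Proposition (pp. 1190–1191)] -/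
private theorem factorial_card_sub_one_le_and_lt [NeZero N] {ℓ : ℕ} (hℓ : ℓ ∈ N.primeFactors) (h5 : ∀ q ∈ N.primeFactors, 5 ≤ q) :
    Nat.factorial (N.primeFactors.card - 1) ≤ ordCompl[ℓ] N ∧ ordCompl[ℓ] N < ℓ ^ orderOf (ℓ : ZMod (ordCompl[ℓ] N)) := by
  classical
  have hN : N ≠ 0 := NeZero.ne N
  have hℓp : ℓ.Prime := Nat.prime_of_mem_primeFactors hℓ
  haveI : NeZero (ordCompl[ℓ] N) := ⟨(Nat.ordCompl_pos ℓ hN).ne'⟩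
  have hMpos : 0 < ordCompl[ℓ] N := Nat.ordCompl_pos ℓ hN
  -- the other primes divide `N_ℓ`
  have mem : ∀ q ∈ N.primeFactors.erase ℓ, q.Prime ∧ 5 ≤ q ∧ q ∣ ordCompl[ℓ] N := by
    intro q hq
    obtain ⟨hqℓ, hqN⟩ := Finset.mem_erase.1 hq
    have hqp : q.Prime := Nat.prime_of_mem_primeFactors hqN
    refine ⟨hqp, h5 q hqN, Nat.dvd_ordCompl_of_dvd_not_dvd (Nat.dvd_of_mem_primeFactors hqN) ?_⟩
    intro h
    exact hqℓ ((Nat.prime_dvd_prime_iff_eq hℓp hqp).1 h).symm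
  have hprod : ∏ q ∈ N.primeFactors.erase ℓ, q ∣ ordCompl[ℓ] N :=
    Finset.prod_primes_dvd _ (fun q hq => Nat.prime_iff.1 (mem q hq).1) fun q hq => (mem q hq).2.2
  have hfact := factorial_card_le_prod (N.primeFactors.erase ℓ) fun q hq => le_trans (by norm_num) (mem q hq).2.1
  rw [Finset.card_erase_of_mem hℓ] at hfact
  refine ⟨hfact.trans (Nat.le_of_dvd hMpos hprod), ?_⟩
  have hcop : ℓ.Coprime (ordCompl[ℓ] N) := Nat.coprime_ordCompl hℓp hN
  have hou : orderOf (ℓ : ZMod (ordCompl[ℓ] N)) = orderOf (ZMod.unitOfCoprime ℓ hcop) := by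
    rw [← ZMod.coe_unitOfCoprime ℓ hcop, orderOf_units]
  have hdvd := dvd_pow_orderOf_sub_one₇ hcop
  rw [← hou] at hdvd
  have hpos : 0 < ℓ ^ orderOf (ℓ : ZMod (ordCompl[ℓ] N)) := pow_pos hℓp.pos _
  have h2 : 2 ≤ ℓ ^ orderOf (ℓ : ZMod (ordCompl[ℓ] N)) :=
    le_trans hℓp.two_le (Nat.le_self_pow (orderOf_cast_pos hℓ).ne' ℓ)
  exact Nat.lt_of_le_pred hpos (Nat.le_of_dvd (Nat.sub_pos_of_lt (lt_of_lt_of_le one_lt_two h2)) hdvd)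

/-- **A failing term bounds `ω(N)`**: if `ℓ ∣ N` (all prime factors of `N` `≥ 5`) and `φ(ℓ^{v_ℓ(N)})·ord_{N_ℓ}(ℓ) ≤ k·ω(N)`, then
`ω(N) ≤ 2·25ᵏ` (`((ω − 1)!)⁴ ≤ N_ℓ⁴ < ℓ^{4d} ≤ 5^{(ℓ−1)d} ≤ 5^{kω}` against `(5ᵏ)ⁿ ≤ n!` for `n ≥ 2·25ᵏ`).
[cite: KoblitzRohrlich1978, §2 proof of the Proposition (p. 1190) and Remark 1 (p. 1192)] -/
theorem card_primeFactors_le_of_totient_mul_orderOf_le [NeZero N] {ℓ k : ℕ} (hℓ : ℓ ∈ N.primeFactors)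
    (h5 : ∀ q ∈ N.primeFactors, 5 ≤ q)
    (hle : (ordProj[ℓ] N).totient * orderOf (ℓ : ZMod (ordCompl[ℓ] N)) ≤ k * N.primeFactors.card) :
    N.primeFactors.card ≤ 2 * 25 ^ k := by
  have hN : N ≠ 0 := NeZero.ne N
  have hℓp : ℓ.Prime := Nat.prime_of_mem_primeFactors hℓ
  have hℓ5 : 5 ≤ ℓ := h5 ℓ hℓ
  obtain ⟨hfact, hlt⟩ := factorial_card_sub_one_le_and_lt hℓ h5
  have hdpos : 0 < orderOf (ℓ : ZMod (ordCompl[ℓ] N)) := orderOf_cast_pos hℓ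
  set d := orderOf (ℓ : ZMod (ordCompl[ℓ] N)) with hd
  set m := N.primeFactors.card with hm
  -- `(ℓ − 1)·d ≤ k·m`
  have ha : 0 < N.factorization ℓ := Nat.Prime.factorization_pos_of_dvd hℓp hN (Nat.dvd_of_mem_primeFactors hℓ)
  have htot : (ordProj[ℓ] N).totient = ℓ ^ (N.factorization ℓ - 1) * (ℓ - 1) := Nat.totient_prime_pow hℓp ha
  have hℓd : (ℓ - 1) * d ≤ k * m := by
    have h1 : 1 ≤ ℓ ^ (N.factorization ℓ - 1) := Nat.one_le_pow _ _ hℓp.pos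
    calc (ℓ - 1) * d = 1 * (ℓ - 1) * d := by ring
      _ ≤ ℓ ^ (N.factorization ℓ - 1) * (ℓ - 1) * d := Nat.mul_le_mul_right _ (Nat.mul_le_mul_right _ h1)
      _ ≤ k * m := by rw [← htot]; exact hle
  -- `((m − 1)!)⁴ < ℓ^{4d} ≤ 5^{(ℓ − 1)d} ≤ 5^{km}`
  have hchain : Nat.factorial (m - 1) ^ 4 < 5 ^ (k * m) := by
    calc Nat.factorial (m - 1) ^ 4 ≤ (ordCompl[ℓ] N) ^ 4 := Nat.pow_le_pow_left hfact 4
      _ < (ℓ ^ d) ^ 4 := Nat.pow_lt_pow_left hlt (by norm_num)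
      _ = (ℓ ^ 4) ^ d := by rw [← pow_mul, ← pow_mul, mul_comm]
      _ ≤ (5 ^ (ℓ - 1)) ^ d := Nat.pow_le_pow_left (pow_four_le_five_pow_sub_one hℓ5) d
      _ = 5 ^ ((ℓ - 1) * d) := by rw [← pow_mul]
      _ ≤ 5 ^ (k * m) := Nat.pow_le_pow_right (by norm_num) hℓd
  by_contra hbig
  rw [not_le] at hbig
  rcases Nat.eq_zero_or_pos k with rfl | hk
  · -- `k = 0`: `(ℓ − 1)·d ≤ 0` is absurd
    have : 4 * 1 ≤ (ℓ - 1) * d := Nat.mul_le_mul (by omega) hdpos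
    omega
  · -- `k ≥ 1`: `(5ᵏ)^{m−1} ≤ (m − 1)!`, so `5^{4k(m−1)} < 5^{km}`, `4(m − 1) < m`
    have h25k : (5 ^ k) ^ 2 = 25 ^ k := by
      rw [← pow_mul, mul_comm, pow_mul]
      norm_num
    have hpow : (5 ^ k) ^ (m - 1) ≤ Nat.factorial (m - 1) :=
      pow_le_factorial_of_two_mul_sq_le (by rw [h25k]; omega)
    have h4 : 5 ^ (k * (4 * (m - 1))) < 5 ^ (k * m) := by
      calc 5 ^ (k * (4 * (m - 1))) = ((5 ^ k) ^ (m - 1)) ^ 4 := by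
            rw [← pow_mul, ← pow_mul]
            ring_nf
        _ ≤ Nat.factorial (m - 1) ^ 4 := Nat.pow_le_pow_left hpow 4
        _ < 5 ^ (k * m) := hchain
    have h5' := (Nat.pow_lt_pow_iff_right (by norm_num : 1 < 5)).1 h4
    have : 4 * (m - 1) < m := Nat.lt_of_mul_lt_mul_left h5'
    have h25 : 1 ≤ 25 ^ k := Nat.one_le_pow _ _ (by norm_num)
    omega

/-- **A failing term bounds `N`**: if `ℓ ∣ N` (all prime factors `≥ 5`) and `φ(ℓ^{v_ℓ(N)})·ord_{N_ℓ}(ℓ) ≤ k·ω(N)`, then with `m = ω(N)`,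
`N < (km + 1)^{km + 2}` (`ℓ ≤ km + 1`, `ℓ^{v_ℓ(N) − 1} ≤ km`, `N_ℓ < ℓᵈ ≤ (km + 1)^{km}`).
[cite: KoblitzRohrlich1978, §2 proof of the Proposition (p. 1190) and Remark 1 (p. 1192)] -/
theorem lt_pow_of_totient_mul_orderOf_le [NeZero N] {ℓ k : ℕ} (hℓ : ℓ ∈ N.primeFactors) (h5 : ∀ q ∈ N.primeFactors, 5 ≤ q)
    (hle : (ordProj[ℓ] N).totient * orderOf (ℓ : ZMod (ordCompl[ℓ] N)) ≤ k * N.primeFactors.card) :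
    N < (k * N.primeFactors.card + 1) ^ (k * N.primeFactors.card + 2) := by
  have hN : N ≠ 0 := NeZero.ne N
  have hℓp : ℓ.Prime := Nat.prime_of_mem_primeFactors hℓ
  have hℓ5 : 5 ≤ ℓ := h5 ℓ hℓ
  obtain ⟨-, hlt⟩ := factorial_card_sub_one_le_and_lt hℓ h5
  have hdpos : 0 < orderOf (ℓ : ZMod (ordCompl[ℓ] N)) := orderOf_cast_pos hℓ
  set d := orderOf (ℓ : ZMod (ordCompl[ℓ] N)) with hd
  set m := N.primeFactors.card with hm
  have ha : 0 < N.factorization ℓ := Nat.Prime.factorization_pos_of_dvd hℓp hN (Nat.dvd_of_mem_primeFactors hℓ)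
  have htot : (ordProj[ℓ] N).totient = ℓ ^ (N.factorization ℓ - 1) * (ℓ - 1) := Nat.totient_prime_pow hℓp ha
  rw [htot] at hle
  set A := ℓ ^ (N.factorization ℓ - 1) with hA
  have hA1 : 1 ≤ A := Nat.one_le_pow _ _ hℓp.pos
  -- `ℓ − 1 ≤ km`, `A ≤ km`, `d ≤ km`
  have hle' : (ℓ - 1) * A * d ≤ k * m := by
    calc (ℓ - 1) * A * d = A * (ℓ - 1) * d := by ring
      _ ≤ k * m := hle
  have hℓkm : ℓ ≤ k * m + 1 := by
    have : ℓ - 1 ≤ k * m := by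
      calc ℓ - 1 = (ℓ - 1) * 1 * 1 := by ring
        _ ≤ (ℓ - 1) * A * d := Nat.mul_le_mul (Nat.mul_le_mul_left _ hA1) hdpos
        _ ≤ k * m := hle'
    omega
  have hAkm : A ≤ k * m := by
    calc A ≤ 4 * A * 1 := by omega
      _ ≤ (ℓ - 1) * A * d := Nat.mul_le_mul (Nat.mul_le_mul_right _ (by omega)) hdpos
      _ ≤ k * m := hle'
  have hdkm : d ≤ k * m := by
    calc d ≤ 4 * 1 * d := by omega
      _ ≤ (ℓ - 1) * A * d := Nat.mul_le_mul_right _ (Nat.mul_le_mul (by omega) hA1)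
      _ ≤ k * m := hle'
  -- `N = ℓ^{a}·N_ℓ = ℓ·A·N_ℓ`
  have hNeq : N = ℓ * A * ordCompl[ℓ] N := by
    have h := Nat.ordProj_mul_ordCompl_eq_self N ℓ
    rw [hA, ← pow_succ', show N.factorization ℓ - 1 + 1 = N.factorization ℓ by omega]
    exact h.symm
  have hM : ordCompl[ℓ] N < (k * m + 1) ^ (k * m) :=
    lt_of_lt_of_le hlt ((Nat.pow_le_pow_left hℓkm d).trans (Nat.pow_le_pow_right (by omega) hdkm))
  calc N = ℓ * A * ordCompl[ℓ] N := hNeq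
    _ < ℓ * A * (k * m + 1) ^ (k * m) := Nat.mul_lt_mul_of_pos_left hM (Nat.mul_pos hℓp.pos (by omega))
    _ ≤ (k * m + 1) * (k * m + 1) * (k * m + 1) ^ (k * m) :=
        Nat.mul_le_mul_right _ (Nat.mul_le_mul hℓkm (hAkm.trans (Nat.le_succ _)))
    _ = (k * m + 1) ^ (k * m + 2) := by ring

end Failing

/-! ## §3 "`lim s(N) = 0`": `2k·#S₀(N) < φ(N)` for all large `N` prime to `6` -/

section Limit

variable {N : ℕ}

/-- **The good case**: if `k·ω(N) < φ(ℓ^{v_ℓ(N)})·ord_{N_ℓ}(ℓ)` for every prime `ℓ ∣ N`, then `2k·#S₀(N) < φ(N)` (K–R's bound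
`s(N) ≤ Σᵢ 1/(φ(pᵢ^{aᵢ})·ordᵢ)` with every term `< 1/(k·ω(N))`). [cite: KoblitzRohrlich1978, §2 proof of the Proposition (p. 1190)] -/
theorem two_mul_mul_card_bad_lt_totient_of_forall_lt [NeZero N] {k : ℕ}
    (h : ∀ ℓ ∈ N.primeFactors, k * N.primeFactors.card < (ordProj[ℓ] N).totient * orderOf (ℓ : ZMod (ordCompl[ℓ] N))) :
    2 * k * Nat.card {χ : DirichletCharacter ℂ N // χ.Odd ∧ bernoulliOneChar χ = 0} < N.totient := by
  classical
  have hN : N ≠ 0 := NeZero.ne N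
  haveI hMi : ∀ ℓ, NeZero (ordCompl[ℓ] N) := fun ℓ => ⟨(Nat.ordCompl_pos ℓ hN).ne'⟩
  set m := N.primeFactors.card with hm
  have hφ : 0 < N.totient := Nat.totient_pos.2 (NeZero.pos N)
  -- per prime: `2(km + 1)·T_ℓ ≤ φ(N)`
  have hper : ∀ ℓ ∈ N.primeFactors,
      2 * (k * m + 1) * Nat.card {ψ : DirichletCharacter ℂ (ordCompl[ℓ] N) // ψ.Odd ∧ ψ (ℓ : ZMod (ordCompl[ℓ] N)) = 1} ≤
        N.totient := by
    intro ℓ hℓ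
    have hℓp : ℓ.Prime := Nat.prime_of_mem_primeFactors hℓ
    have hcop : ℓ.Coprime (ordCompl[ℓ] N) := Nat.coprime_ordCompl hℓp hN
    have hT : Nat.card {ψ : DirichletCharacter ℂ (ordCompl[ℓ] N) // ψ.Odd ∧ ψ (ℓ : ZMod (ordCompl[ℓ] N)) = 1} =
        Nat.card {ψ : DirichletCharacter ℂ (ordCompl[ℓ] N) // ψ.Odd ∧ ψ (ZMod.unitOfCoprime ℓ hcop) = 1} := by
      refine Nat.card_congr (Equiv.subtypeEquivRight fun ψ => ?_)
      rw [ZMod.coe_unitOfCoprime]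
    have hou : orderOf (ℓ : ZMod (ordCompl[ℓ] N)) = orderOf (ZMod.unitOfCoprime ℓ hcop) := by
      rw [← ZMod.coe_unitOfCoprime ℓ hcop, orderOf_units]
    have hkd : k * m + 1 ≤ (ordProj[ℓ] N).totient * orderOf (ZMod.unitOfCoprime ℓ hcop) := by
      have := h ℓ hℓ
      rw [hou] at this
      exact this
    rw [hT]
    set T := Nat.card {ψ : DirichletCharacter ℂ (ordCompl[ℓ] N) // ψ.Odd ∧ ψ (ZMod.unitOfCoprime ℓ hcop) = 1}
    set d := orderOf (ZMod.unitOfCoprime ℓ hcop)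
    have h2 : 2 * d * T ≤ (ordCompl[ℓ] N).totient := two_mul_orderOf_mul_card_odd_apply_eq_one_le _
    calc 2 * (k * m + 1) * T ≤ 2 * ((ordProj[ℓ] N).totient * d) * T := Nat.mul_le_mul_right _ (Nat.mul_le_mul_left 2 hkd)
      _ = (ordProj[ℓ] N).totient * (2 * d * T) := by ring
      _ ≤ (ordProj[ℓ] N).totient * (ordCompl[ℓ] N).totient := Nat.mul_le_mul_left _ h2
      _ = N.totient := (totient_eq_totient_ordProj_mul hℓp hN).symm
  have hsum : 2 * (k * m + 1) * ∑ ℓ ∈ N.primeFactors,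
      Nat.card {ψ : DirichletCharacter ℂ (ordCompl[ℓ] N) // ψ.Odd ∧ ψ (ℓ : ZMod (ordCompl[ℓ] N)) = 1} ≤ m * N.totient := by
    rw [Finset.mul_sum]
    have := Finset.sum_le_sum hper
    rwa [Finset.sum_const, smul_eq_mul] at this
  have hS₀ := card_odd_bernoulliOneChar_eq_zero_le (N := N)
  set S := ∑ ℓ ∈ N.primeFactors,
      Nat.card {ψ : DirichletCharacter ℂ (ordCompl[ℓ] N) // ψ.Odd ∧ ψ (ℓ : ZMod (ordCompl[ℓ] N)) = 1} with hS
  -- `2(km + 1)·S ≤ m·φ(N)` forces `2k·S < φ(N)`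
  have hkS : 2 * k * S < N.totient := by
    by_contra hge
    rw [not_lt] at hge
    rcases Nat.eq_zero_or_pos m with hm0 | hmpos
    · -- no prime factor: `S = 0`
      have he : N.primeFactors = ∅ := Finset.card_eq_zero.1 (by omega)
      have hS0 : S = 0 := by rw [hS, he, Finset.sum_empty]
      rw [hS0, mul_zero] at hge
      omega
    · have h1 : m * N.totient ≤ m * (2 * k * S) := Nat.mul_le_mul_left m hge
      have h2 : 2 * (k * m + 1) * S = m * (2 * k * S) + 2 * S := by ring
      have hS0 : S = 0 := by omega
      rw [hS0, mul_zero] at hge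
      omega
  exact lt_of_le_of_lt (Nat.mul_le_mul_left _ hS₀) hkS

/-- **REMARK 1, "`lim s(N) = 0`", with an explicit threshold**: for every `k` and every level `N ≥ (2k·25ᵏ + 1)^{2k·25ᵏ + 2}` all of whose
prime factors are `≥ 5`, `2k·#S₀(N) < φ(N)` — that is, `#S₀(N) < (1/k)·#S(N)` with `#S(N) = φ(N)/2`.
[cite: KoblitzRohrlich1978, §2 Remark 1 (p. 1192) and proof of the Proposition (p. 1190)] -/
theorem two_mul_mul_card_bad_lt_totient_of_le [NeZero N] {k : ℕ} (h5 : ∀ ℓ ∈ N.primeFactors, 5 ≤ ℓ)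
    (hN : (k * (2 * 25 ^ k) + 1) ^ (k * (2 * 25 ^ k) + 2) ≤ N) :
    2 * k * Nat.card {χ : DirichletCharacter ℂ N // χ.Odd ∧ bernoulliOneChar χ = 0} < N.totient := by
  by_cases hgood : ∀ ℓ ∈ N.primeFactors, k * N.primeFactors.card < (ordProj[ℓ] N).totient * orderOf (ℓ : ZMod (ordCompl[ℓ] N))
  · exact two_mul_mul_card_bad_lt_totient_of_forall_lt hgood
  · exfalso
    push Not at hgood
    obtain ⟨ℓ, hℓ, hle⟩ := hgood
    have hm : N.primeFactors.card ≤ 2 * 25 ^ k := card_primeFactors_le_of_totient_mul_orderOf_le hℓ h5 hle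
    have hlt : N < (k * N.primeFactors.card + 1) ^ (k * N.primeFactors.card + 2) := lt_pow_of_totient_mul_orderOf_le hℓ h5 hle
    have hkm : k * N.primeFactors.card ≤ k * (2 * 25 ^ k) := Nat.mul_le_mul_left k hm
    have hmono : (k * N.primeFactors.card + 1) ^ (k * N.primeFactors.card + 2) ≤ (k * (2 * 25 ^ k) + 1) ^ (k * (2 * 25 ^ k) + 2) :=
      (Nat.pow_le_pow_left (by omega) _).trans (Nat.pow_le_pow_right (by omega) (by omega))
    omega

/-- **"`lim s(N) = 0`", `∃ N₀` form**: for every `k` there is `N₀` such that `2k·#S₀(N) < φ(N)` for every `N ≥ N₀` with all prime factors `≥ 5`.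
[cite: KoblitzRohrlich1978, §2 Remark 1 (p. 1192)] -/
theorem exists_forall_two_mul_mul_card_bad_lt_totient (k : ℕ) :
    ∃ N₀ : ℕ, ∀ (N : ℕ) [NeZero N], N₀ ≤ N → (∀ ℓ ∈ N.primeFactors, 5 ≤ ℓ) →
      2 * k * Nat.card {χ : DirichletCharacter ℂ N // χ.Odd ∧ bernoulliOneChar χ = 0} < N.totient :=
  ⟨(k * (2 * 25 ^ k) + 1) ^ (k * (2 * 25 ^ k) + 2), fun _ _ hN h5 => two_mul_mul_card_bad_lt_totient_of_le h5 hN⟩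

/-- A level with a prime factor, all prime factors `≥ 5`, exceeds `2` (private copy). [folklore] -/
private theorem two_lt_of_primeFactors₇ [NeZero N] (hne : N.primeFactors.Nonempty) (h5 : ∀ ℓ ∈ N.primeFactors, 5 ≤ ℓ) : 2 < N := by
  obtain ⟨ℓ, hℓ⟩ := hne
  have hle : ℓ ≤ N := Nat.le_of_dvd (NeZero.pos N) (Nat.dvd_of_mem_primeFactors hℓ)
  have := h5 ℓ hℓ
  omega

/-- The threshold exceeds `1` (`k ≥ 1`). [folklore] -/
private theorem one_lt_threshold {k : ℕ} (hk : 0 < k) : 1 < (k * (2 * 25 ^ k) + 1) ^ (k * (2 * 25 ^ k) + 2) := by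
  have h25 : 1 ≤ 25 ^ k := Nat.one_le_pow _ _ (by norm_num)
  have h2 : 2 ≤ k * (2 * 25 ^ k) + 1 := by nlinarith
  calc 1 < k * (2 * 25 ^ k) + 1 := by omega
    _ = (k * (2 * 25 ^ k) + 1) ^ 1 := (pow_one _).symm
    _ ≤ (k * (2 * 25 ^ k) + 1) ^ (k * (2 * 25 ^ k) + 2) := Nat.pow_le_pow_right (by omega) (by omega)

/-- **`k·#S₀(N) < #S(N)` for all large `N` prime to `6`** (`k ≥ 1`; `#S(N)` = the number of odd characters mod `N` `= φ(N)/2`).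
[cite: KoblitzRohrlich1978, §2 Remark 1 (p. 1192)] -/
theorem mul_card_bad_lt_card_odd_of_le [NeZero N] {k : ℕ} (hk : 0 < k) (h5 : ∀ ℓ ∈ N.primeFactors, 5 ≤ ℓ)
    (hN : (k * (2 * 25 ^ k) + 1) ^ (k * (2 * 25 ^ k) + 2) ≤ N) :
    k * Nat.card {χ : DirichletCharacter ℂ N // χ.Odd ∧ bernoulliOneChar χ = 0} < Nat.card {χ : DirichletCharacter ℂ N // χ.Odd} := by
  have hN1 : 1 < N := lt_of_lt_of_le (one_lt_threshold hk) hN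
  have hN2 : 2 < N := two_lt_of_primeFactors₇ (Nat.nonempty_primeFactors.2 hN1) h5
  have hS := two_mul_card_odd_eq_totient' (M := N) hN2
  have h := two_mul_mul_card_bad_lt_totient_of_le h5 hN
  rw [mul_assoc] at h
  omega

/-- **`s(N) < 1/k` for all large `N` prime to `6`**: for `k ≥ 1` and `N ≥ (2k·25ᵏ + 1)^{2k·25ᵏ + 2}` with all prime factors `≥ 5`,
`#S₀(N)/#S(N) < 1/k`. [cite: KoblitzRohrlich1978, §2 Remark 1 (p. 1192)] -/
theorem s_lt_one_div_of_le [NeZero N] {k : ℕ} (hk : 0 < k) (h5 : ∀ ℓ ∈ N.primeFactors, 5 ≤ ℓ)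
    (hN : (k * (2 * 25 ^ k) + 1) ^ (k * (2 * 25 ^ k) + 2) ≤ N) :
    (Nat.card {χ : DirichletCharacter ℂ N // χ.Odd ∧ bernoulliOneChar χ = 0} : ℚ) /
        Nat.card {χ : DirichletCharacter ℂ N // χ.Odd} < 1 / k := by
  have hN1 : 1 < N := lt_of_lt_of_le (one_lt_threshold hk) hN
  have hN2 : 2 < N := two_lt_of_primeFactors₇ (Nat.nonempty_primeFactors.2 hN1) h5
  have hS := two_mul_card_odd_eq_totient' (M := N) hN2
  have hSpos : 0 < Nat.card {χ : DirichletCharacter ℂ N // χ.Odd} := by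
    have := Nat.totient_pos.2 (NeZero.pos N)
    omega
  have h := mul_card_bad_lt_card_odd_of_le hk h5 hN
  have h' : Nat.card {χ : DirichletCharacter ℂ N // χ.Odd ∧ bernoulliOneChar χ = 0} * k <
      1 * Nat.card {χ : DirichletCharacter ℂ N // χ.Odd} := by
    rw [mul_comm, one_mul]
    exact h
  rw [div_lt_div_iff₀ (by exact_mod_cast hSpos) (by exact_mod_cast hk)]
  exact_mod_cast h'

/-- **REMARK 1, "It is also clear that `lim s(N) = 0`"** (the `ε`-form): for every rational `ε > 0` there is `N₀` such that
`s(N) = #S₀(N)/#S(N) < ε` for every level `N ≥ N₀` all of whose prime factors are `≥ 5`.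
[cite: KoblitzRohrlich1978, §2 Remark 1 (p. 1192)] -/
theorem exists_forall_s_lt (ε : ℚ) (hε : 0 < ε) :
    ∃ N₀ : ℕ, ∀ (N : ℕ) [NeZero N], N₀ ≤ N → (∀ ℓ ∈ N.primeFactors, 5 ≤ ℓ) →
      (Nat.card {χ : DirichletCharacter ℂ N // χ.Odd ∧ bernoulliOneChar χ = 0} : ℚ) /
          Nat.card {χ : DirichletCharacter ℂ N // χ.Odd} < ε := by
  obtain ⟨k, hk⟩ := exists_nat_gt (1 / ε)
  have hkpos' : (0 : ℚ) < k := lt_trans (one_div_pos.2 hε) hk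
  have hkpos : 0 < k := by exact_mod_cast hkpos'
  refine ⟨(k * (2 * 25 ^ k) + 1) ^ (k * (2 * 25 ^ k) + 2), fun N _ hN h5 => ?_⟩
  have h := s_lt_one_div_of_le hkpos h5 hN
  have hkε : (1 : ℚ) / k < ε := by
    rw [div_lt_iff₀ hkpos']
    have := (div_lt_iff₀ hε).1 hk
    linarith
  exact lt_trans h hkε

end Limit

end CyclotomicFermatCMType

end Literature.AlgebraicGeometry.ComplexMultiplication
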